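import Summits.QuantumFields.YangMills.Theorems.UnitScaleTiltProp7GramDifferenceRowSum
import Summits.QuantumFields.YangMills.Theorems.UnitScaleTiltProp7GramDifferenceNearRow
import HarnessLib

/-!
# Route `UnitScaleTilt`, crux K1 «MinimiserStabilityRegPr» (stmt-QuantumFields-19200), EX row `hGF[Lift]` (curved member) — **LOD LINE, PEN (L5″) (RN) KNIT (ABSTRACT):
# THE `hRN` ROW OF THE `hloc` DOCK FROM THE (RN-near) DISPLAYED ROWS AND THE (RN-far) TAIL** — routeR-w3 g12 2026-08-30 02:38:20Z «routeR-w2: knit RN» GO.  Composition of three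
# landed pieces, at the level of abstract inner-product spaces (letters of ✓`Prop7LocalProjectorRowOfMemberRows.norm_inner_starProjection_sub_le_of_member_rows`, p755439):
# * px5 g11's (RN-near) operator knit ✓`Prop7GramDifferenceNearRow.norm_gram_apply_sub_le_near` (p757045): `‖S_1G_1G_1T_1 c − S_WG_WG_WT_W c‖ ≤ ε_N‖c‖` from the `S`-row with tail,
#   the cut-off-fixed `G`-row, the `T`-row, the plateau fixing of `T_1 c` and two tail numbers, `ε_N = δ_S·ν²C_T + s·τ_u + C_S(c_G·νC_T + 2ν·τ_v + ν·c_G·C_T + ν²·δ_T)`;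
# * this seat's RN-SUM ✓`Prop7GramDifferenceRowSum` (p756859): `hnear_of_operator_row` (Parseval: the operator row IS the 2r-door's coordinate `hnear`) and `hRN_of_near_far`
#   (the 2r-door ✓p755902 with `hA`, `hc` discharged);
# * the (RN-far) tail `htail : √Σ_y‖(if y ∈ N then 0 else (M′⁻¹b_f)_y)‖² ≤ τ‖f‖` (member: ✓`Prop7GramInverseFarTailMember.sqrt_sum_normSq_far_gramInv_coords_le`, p757450).
# RESULT ★★★ `hRN_of_rows`: with the (RN-near) rows read ∀ over the coordinate vectors `d` supported in the near index set `N`, `‖M′⁻¹‖ ≤ ν′` and `htail`,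
# **`√Σ_y‖((M′ − M)(M′⁻¹b_f))_y‖² ≤ (ε_N·(ν′·(C_S·ν)) + (C_S·ν²·C_T + C_S·ν²·C_T)·τ)·‖f‖`** — the `hRN` binder of ✓p755439 with `δ_M := ε_N·ν′·C_S·ν + 2C_S·ν²·C_T·τ`.

Cell `ym3-torus` (HUMAN RULING D-0037, YM ladder rung R3 — NOT d = 4, NOT infinite volume, NOT a mass gap, NOT Clay).  Width seat `ym-routeR-w2` gen 13.  THEOREMS ONLY (0 `def`, 0 `sorry`),
Mathlib-level over ✓p756859 + ✓p757045; `--supports stmt-QuantumFields-19200 --as helper`, count-neutral.  HONEST LABEL (★★OWNER RULING №33 (6)): curved γ-row supplier line (LOD localisation),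
pen (L5″); bookkeeping in hypothesis form — every analytic input is a displayed row of px5 g11 ∕ routeR-w2 (B-series); nothing of (RN) beyond this composition, (3.49), Thm 3.1∕3.3, `h349`,
`hGF`, EX ∕ 19200 is proved here; the decay length `1∕μ′` inside `τ` is the window's (quantitative flag of record stands).

WHAT IS PROVED (ns `Summit.QuantumFields.YangMills.Theorems.Prop7GramDifferenceRowKnit`).
* `epsNear_nonneg` (the sign of `ε_N`), ★★ `hnear_of_rows` (the 2r-door's `hnear` from the (RN-near) displayed rows), ★★★ `hRN_of_rows` (the `hRN` binder of ✓p755439).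

References: T. Bałaban, CMP **99** (1985) 389–434 [Balaban1985BackgroundPropagators] ((3.21)–(3.26) pp.394–395, (3.49) p.399, Thm 3.3 p.399, (3.105)–(3.106) p.414).
-/

set_option autoImplicit false

noncomputable section

open scoped InnerProductSpace ComplexConjugate BigOperators Matrix Matrix.Norms.L2Operator

namespace Summit.QuantumFields.YangMills.Theorems.Prop7GramDifferenceRowKnit

open Summit.QuantumFields.YangMills.Theorems.Prop7GramDifferenceRowSum (hnear_of_operator_row hRN_of_near_far)
open Summit.QuantumFields.YangMills.Theorems.Prop7GramDifferenceNearRow (norm_gram_apply_sub_le_near)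

variable {E C : Type*} [NormedAddCommGroup E] [InnerProductSpace ℂ E] [NormedAddCommGroup C] [InnerProductSpace ℂ C] {m : Type*} [Fintype m] [DecidableEq m]

/-- The (RN-near) constant `ε_N = δ_S·ν²C_T + s·τ_u + C_S(c_G·νC_T + 2ν·τ_v + ν·c_G·C_T + ν²·δ_T)` is `≥ 0` when its letters are. [folklore] -/
theorem epsNear_nonneg {CS CT ν δT δS s cG τv τu : ℝ} (hCS : 0 ≤ CS) (hCT : 0 ≤ CT) (hν : 0 ≤ ν) (hδT : 0 ≤ δT) (hδS : 0 ≤ δS) (hs : 0 ≤ s) (hcG : 0 ≤ cG)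
    (hτv : 0 ≤ τv) (hτu : 0 ≤ τu) :
    0 ≤ δS * (ν ^ 2 * CT) + s * τu + CS * (cG * (ν * CT) + 2 * ν * τv + ν * (cG * CT) + ν ^ 2 * δT) := by
  positivity

omit [DecidableEq m] in
/-- ★★ **THE 2r-DOOR'S `hnear` FROM THE (RN-near) DISPLAYED ROWS**: two systems `(G_W,T_W,S_W)`, `(G_1,T_1,S_1)` over one orthonormal coarse basis `b` (symmetric `G`, adjoint pairs, Grams
`M, M′`), cut-offs `Xp` (plateau), `Xt` (fattened; `Xp∘Xt = Xt`, `‖Xt·‖ ≤ ‖·‖`), global sizes `‖S_W·‖ ≤ C_S‖·‖`, `‖G_1·‖,‖G_W·‖ ≤ ν‖·‖`, `‖T_1·‖ ≤ C_T‖·‖`, the `S`-row with tail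
`‖S_1u − S_Wu‖ ≤ δ_S‖u‖ + s‖u − Xt u‖`, the cut-off-fixed `G`-row, and — for every coordinate vector `d` supported in `N`, `d̃ = Σ d_y • b_y` — the `T`-row `‖T_1d̃ − T_Wd̃‖ ≤ δ_T‖d̃‖`, the
plateau fixing `Xp(T_1 d̃) = T_1 d̃` and the tails `‖v − Xt v‖ ≤ τ_v‖d̃‖`, `‖u − Xt u‖ ≤ τ_u‖d̃‖` (`v = G_1T_1d̃`, `u = G_1v`) ⟹
`∀ d, (∀ y ∉ N, d_y = 0) → √Σ_y‖((M′ − M)d)_y‖² ≤ ε_N·√Σ_y‖d_y‖²` (✓p757045 read through ✓p756859's Parseval).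
[cite: Balaban1985BackgroundPropagators, (3.21)–(3.23) p.394, (3.49) p.399, Thm 3.3 p.399] -/
theorem hnear_of_rows (b : OrthonormalBasis m ℂ C) (GW G1 : E →ₗ[ℂ] E) (TW T1 : C →ₗ[ℂ] E) (SW S1 : E →ₗ[ℂ] C) (Xp Xt : E →ₗ[ℂ] E)
    (hGW : ∀ x y : E, ⟪GW x, y⟫_ℂ = ⟪x, GW y⟫_ℂ) (hG1 : ∀ x y : E, ⟪G1 x, y⟫_ℂ = ⟪x, G1 y⟫_ℂ)
    (hTW : ∀ (l : E) (c : C), ⟪SW l, c⟫_ℂ = ⟪l, TW c⟫_ℂ) (hT1 : ∀ (l : E) (c : C), ⟪S1 l, c⟫_ℂ = ⟪l, T1 c⟫_ℂ)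
    {M M' : Matrix m m ℂ} (hM : ∀ y y', M y y' = ⟪GW (TW (b y)), GW (TW (b y'))⟫_ℂ) (hM' : ∀ y y', M' y y' = ⟪G1 (T1 (b y)), G1 (T1 (b y'))⟫_ℂ)
    {CS CT ν δT δS s cG τv τu : ℝ} (hCS : 0 ≤ CS) (hν : 0 ≤ ν) (hδS : 0 ≤ δS) (hs : 0 ≤ s) (hcG : 0 ≤ cG)
    (hSWb : ∀ l, ‖SW l‖ ≤ CS * ‖l‖) (hG1b : ∀ v, ‖G1 v‖ ≤ ν * ‖v‖) (hGWb : ∀ v, ‖GW v‖ ≤ ν * ‖v‖) (hT1b : ∀ c, ‖T1 c‖ ≤ CT * ‖c‖)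
    (hS : ∀ u, ‖S1 u - SW u‖ ≤ δS * ‖u‖ + s * ‖u - Xt u‖)
    (hRB1 : ∀ h : E, Xp h = h → ‖G1 h - GW h‖ ≤ cG * ‖h‖) (hXpXt : ∀ v, Xp (Xt v) = Xt v) (hXt : ∀ v, ‖Xt v‖ ≤ ‖v‖)
    (N : Finset m)
    (hT : ∀ d : m → ℂ, (∀ y, y ∉ N → d y = 0) → ‖T1 (∑ y', d y' • b y') - TW (∑ y', d y' • b y')‖ ≤ δT * ‖∑ y', d y' • b y'‖)
    (hXpT : ∀ d : m → ℂ, (∀ y, y ∉ N → d y = 0) → Xp (T1 (∑ y', d y' • b y')) = T1 (∑ y', d y' • b y'))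
    (hτv : ∀ d : m → ℂ, (∀ y, y ∉ N → d y = 0) → ‖G1 (T1 (∑ y', d y' • b y')) - Xt (G1 (T1 (∑ y', d y' • b y')))‖ ≤ τv * ‖∑ y', d y' • b y'‖)
    (hτu : ∀ d : m → ℂ, (∀ y, y ∉ N → d y = 0) →
      ‖G1 (G1 (T1 (∑ y', d y' • b y'))) - Xt (G1 (G1 (T1 (∑ y', d y' • b y'))))‖ ≤ τu * ‖∑ y', d y' • b y'‖) :
    ∀ d : m → ℂ, (∀ y, y ∉ N → d y = 0) →
      Real.sqrt (∑ y, ‖((M' - M) *ᵥ d) y‖ ^ 2)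
        ≤ (δS * (ν ^ 2 * CT) + s * τu + CS * (cG * (ν * CT) + 2 * ν * τv + ν * (cG * CT) + ν ^ 2 * δT)) * Real.sqrt (∑ y, ‖d y‖ ^ 2) :=
  hnear_of_operator_row b GW G1 TW T1 SW S1 hGW hG1 hTW hT1 hM hM' N fun d hd =>
    norm_gram_apply_sub_le_near S1 SW T1 TW G1 GW Xp Xt hCS hν hδS hs hcG hSWb hG1b hGWb hS hRB1 hXpXt hXt (∑ y', d y' • b y')
      (hT1b _) (hT d hd) (hXpT d hd) (hτv d hd) (hτu d hd)

/-- ★★★ **THE `hRN` BINDER OF ✓`Prop7LocalProjectorRowOfMemberRows.norm_inner_starProjection_sub_le_of_member_rows` FROM THE DISPLAYED ROWS** (routeR-w3 g12 «knit RN»): the hypotheses of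
`hnear_of_rows`, the global sizes of BOTH systems (`‖S·‖ ≤ C_S‖·‖`, `‖G·‖ ≤ ν‖·‖`, `‖T·‖ ≤ C_T‖·‖`), `‖M′⁻¹‖ ≤ ν′`, and at the vector `f` the (RN-far) tail
`√Σ_y‖(if y ∈ N then 0 else (M′⁻¹b_f)_y)‖² ≤ τ‖f‖` (`(b_f)_y = ⟪G_W(T_W(b_y)), f⟫`; ✓`Prop7GramInverseFarTailMember.sqrt_sum_normSq_far_gramInv_coords_le` at the member) give
**`√Σ_y‖((M′ − M)(M′⁻¹b_f))_y‖² ≤ (ε_N·(ν′·(C_S·ν)) + (C_S·ν²·C_T + C_S·ν²·C_T)·τ)·‖f‖`**, `ε_N = δ_S·ν²C_T + s·τ_u + C_S(c_G·νC_T + 2ν·τ_v + ν·c_G·C_T + ν²·δ_T)`.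
[cite: Balaban1985BackgroundPropagators, (3.21)–(3.26) pp.394–395, (3.49) p.399, Thm 3.3 p.399, (3.105)–(3.106) p.414] -/
theorem hRN_of_rows (b : OrthonormalBasis m ℂ C) (GW G1 : E →ₗ[ℂ] E) (TW T1 : C →ₗ[ℂ] E) (SW S1 : E →ₗ[ℂ] C) (Xp Xt : E →ₗ[ℂ] E)
    (hGW : ∀ x y : E, ⟪GW x, y⟫_ℂ = ⟪x, GW y⟫_ℂ) (hG1 : ∀ x y : E, ⟪G1 x, y⟫_ℂ = ⟪x, G1 y⟫_ℂ)
    (hTW : ∀ (l : E) (c : C), ⟪SW l, c⟫_ℂ = ⟪l, TW c⟫_ℂ) (hT1 : ∀ (l : E) (c : C), ⟪S1 l, c⟫_ℂ = ⟪l, T1 c⟫_ℂ)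
    {M M' : Matrix m m ℂ} (hM : ∀ y y', M y y' = ⟪GW (TW (b y)), GW (TW (b y'))⟫_ℂ) (hM' : ∀ y y', M' y y' = ⟪G1 (T1 (b y)), G1 (T1 (b y'))⟫_ℂ)
    {CS CT ν ν' δT δS s cG τv τu τ : ℝ} (hCS : 0 ≤ CS) (hCT : 0 ≤ CT) (hν : 0 ≤ ν) (hν' : 0 ≤ ν') (hδT : 0 ≤ δT) (hδS : 0 ≤ δS) (hs : 0 ≤ s) (hcG : 0 ≤ cG)
    (hτv0 : 0 ≤ τv) (hτu0 : 0 ≤ τu)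
    (hSWb : ∀ l, ‖SW l‖ ≤ CS * ‖l‖) (hS1b : ∀ l, ‖S1 l‖ ≤ CS * ‖l‖) (hGWb : ∀ v, ‖GW v‖ ≤ ν * ‖v‖) (hG1b : ∀ v, ‖G1 v‖ ≤ ν * ‖v‖)
    (hTWb : ∀ c, ‖TW c‖ ≤ CT * ‖c‖) (hT1b : ∀ c, ‖T1 c‖ ≤ CT * ‖c‖)
    (hS : ∀ u, ‖S1 u - SW u‖ ≤ δS * ‖u‖ + s * ‖u - Xt u‖)
    (hRB1 : ∀ h : E, Xp h = h → ‖G1 h - GW h‖ ≤ cG * ‖h‖) (hXpXt : ∀ v, Xp (Xt v) = Xt v) (hXt : ∀ v, ‖Xt v‖ ≤ ‖v‖)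
    (N : Finset m)
    (hT : ∀ d : m → ℂ, (∀ y, y ∉ N → d y = 0) → ‖T1 (∑ y', d y' • b y') - TW (∑ y', d y' • b y')‖ ≤ δT * ‖∑ y', d y' • b y'‖)
    (hXpT : ∀ d : m → ℂ, (∀ y, y ∉ N → d y = 0) → Xp (T1 (∑ y', d y' • b y')) = T1 (∑ y', d y' • b y'))
    (hτv : ∀ d : m → ℂ, (∀ y, y ∉ N → d y = 0) → ‖G1 (T1 (∑ y', d y' • b y')) - Xt (G1 (T1 (∑ y', d y' • b y')))‖ ≤ τv * ‖∑ y', d y' • b y'‖)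
    (hτu : ∀ d : m → ℂ, (∀ y, y ∉ N → d y = 0) →
      ‖G1 (G1 (T1 (∑ y', d y' • b y'))) - Xt (G1 (G1 (T1 (∑ y', d y' • b y'))))‖ ≤ τu * ‖∑ y', d y' • b y'‖)
    (hN' : ‖M'⁻¹‖ ≤ ν') (f : E)
    (htail : Real.sqrt (∑ y, ‖(if y ∈ N then (0 : ℂ) else (M'⁻¹ *ᵥ fun y' => ⟪GW (TW (b y')), f⟫_ℂ) y)‖ ^ 2) ≤ τ * ‖f‖) :
    Real.sqrt (∑ y, ‖((M' - M) *ᵥ (M'⁻¹ *ᵥ fun y' => ⟪GW (TW (b y')), f⟫_ℂ)) y‖ ^ 2)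
      ≤ ((δS * (ν ^ 2 * CT) + s * τu + CS * (cG * (ν * CT) + 2 * ν * τv + ν * (cG * CT) + ν ^ 2 * δT)) * (ν' * (CS * ν))
          + (CS * ν ^ 2 * CT + CS * ν ^ 2 * CT) * τ) * ‖f‖ :=
  hRN_of_near_far b GW G1 TW T1 SW S1 hGW hG1 hTW hT1 hM hM' hCS hν hCT hCS hν hCT hν' hSWb hGWb hTWb hS1b hG1b hT1b hN' N
    (epsNear_nonneg hCS hCT hν hδT hδS hs hcG hτv0 hτu0)
    (hnear_of_rows b GW G1 TW T1 SW S1 Xp Xt hGW hG1 hTW hT1 hM hM' hCS hν hδS hs hcG hSWb hG1b hGWb hT1b hS hRB1 hXpXt hXt N hT hXpT hτv hτu) f htail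

end Summit.QuantumFields.YangMills.Theorems.Prop7GramDifferenceRowKnit

end
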